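import Summits.NavierStokesRegularity.FluidComputer.TriggeredTransferSteadyBlob

/-!
# Fluid computer, door N1-FC — the door's static type and its one-step predicate are INHABITED
# (kernel non-vacuity; and the zero-viscosity / unit-trigger DEGENERACY of `TriggerScheme.Step`)

Cell `ns-blowup`, seat `ns-blowup-fc-prover-1` (g3; D-0074 GROUP C «bridge support»; LADDER-NS rung
N1-FC). Third of three files (`TriggeredTransferTransplant` → `TriggeredTransferSteadyBlob` → this).
Companion of `TriggeredTransfer.lean` (seat `ns-blowup-fc-route`: the door vocabulary
`TriggerScheme`, `IsTrigger`, `Step`, `Transfers` — «a TYPE; no instance is claimed») and of this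
seat's `TriggeredTransferLedger` / `…Run` / `…Witness` (the analysis half of the door: every scheme
that `Transfers` at `ν > 0` yields Fefferman's breakdown (C)). LABEL: E–C typing / calibration.

WHAT THIS IS NOT: not Navier–Stokes evidence and not a transfer performed by any fluid. The flow used
here (`SteadyBlob.flow`, previous file) is PRESCRIBED: a compactly supported steady EULER blob
(Gavrilov 2019, the tree THEOREM `gavrilov_compact_steady_euler_holds`) faded out while a disjoint,
`λ`-zoomed copy of it is faded in, the whole motion being paid for by a force of UNIT size. Nothing is
claimed about `Transfers ν` for any `ν`, nor about small trigger amplitudes; see «Reading» below.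

## What is proved

* `SteadyBlob.scheme : TriggerScheme` — the GAVRILOV ALPHABET of a steady Euler blob `B = (G, P, r)`:
  `λ = 2`, `η = 1` (so `1 < ηλ`), `U⋆ = 1`, `F U = {x ↦ U • G x}`, nest radius `5r`, speed-floor
  constant `‖G x⋆‖`, displacement bound `D = 4r`, trigger constants `A i` = a bound of the `i`-th
  space–time derivative of the transplant force `B.trig` (`SteadyBlob.trig_bounded`), `a = 1`,
  `C_τ = 4`, `q = 0`; ALL static axioms (`clay`, `floor`, `seed`, signs) are discharged, so
  `nonempty_triggerScheme : Nonempty TriggerScheme` — until now the tree's only producer of schemes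
  was `TriggerScheme.fatten : TriggerScheme → TriggerScheme`.
* `SteadyBlob.isTrigger_trig` — the transplant force is an admissible trigger of amplitude `ε = 1`
  for margin `δ = 1` and hand-over time `T = 4` (it lives on `[2, 3] × B̄(0, 5r)`).
* `SteadyBlob.step_one` — **the one-shot triggered-transfer predicate `TriggerScheme.Step` is
  inhabited**: `B.scheme.Step 0 1 1 (x ↦ 1 • G x)`, i.e. at viscosity `ν = 0`, amplitude `U = 1`,
  trigger amplitude `ε = 1`: hand-over time `T = 4 ≤ C_τ (1 + |log 1|)^0 / 1`, margin `δ = 1`,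
  solution = the transplant `B.flow` (a classical forced Euler flow on `[0, 5]` with finite energy,
  `SteadyBlob.flow_classical`, `.flow_energy`), `u 0 = 1 • G`, and `u 4 = W₂ =
  x ↦ λ • w′ (λ • (x - x₀))` with `w′ = √2 • G ∈ F √2` one amplitude level up (`√2 = (ηλ)^{1/2}`),
  `‖x₀‖ = 4r ≤ D`; packaged as
  `exists_step_inviscid_unit_trigger : ∃ 𝒮 U w, 𝒮.UStar ≤ U ∧ w ∈ 𝒮.F U ∧ 𝒮.Step 0 U 1 w`.

## Reading (the honest calibration this buys)

(1) NON-VACUITY. The door's static type and its one-step predicate are satisfiable exactly as typed,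
all clauses at once (trigger off before `δ` and after `T` and outside the nest ball, `u 0 = w`, exact
zoomed hand-over into the family one level up, the time law `T ≤ C_τ (1 + |log ε|)^q / U`, finite
energy): the vocabulary hides no contradiction, which is the kernel check a tribunal's BC5 / T1 asks
of a crux predicate «in a regime where S is not known» (fc-route's route-shape note, STATUS l.2095 (2)).
(2) DEGENERACY. At `ν = 0` the admissibility clause `ν |log ε| ≤ a U` of `Transfers` is void, and with
a trigger of UNIT relative size the FORCE performs the transfer while the fluid does nothing: the
transplant is the door's analogue of the junk-stage probes P1/P2 of route `PalasekTowerBreakdown`.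
The content of door N1-FC is therefore carried ENTIRELY by the quantification of `Transfers ν`,
`ν > 0`, over trigger amplitudes `ε ↓ 0` under the e-fold budget (the triggers of the transplant have
size comparable to the displacement `‖W₂ - W₁‖ ≥ c U` divided by the window `T ≤ C_τ / U`, never
small) — which is exactly what the cascade gluing (`TriggeredTransferWitness`) consumes through the
level seeds `ε_n ↓ 0`. No claim is made that `B.scheme.Transfers 0` fails: the `Step`'s solution class
(finite energy, no decay of derivatives or pressure) does not support the energy identity that would
be needed to prove it.

0 sorry; axioms ⊆ {propext, Classical.choice, Quot.sound}. References: A. V. Gavrilov, Geom. Funct.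
Anal. 29 (2019) 190–197, §1 Theorem [cite: Gavrilov2019, §1 Theorem]; T. Tao, J. Amer. Math. Soc. 29
(2016) §1.3 (gates, one-shot transfer, noise tolerance) [cite: Tao2016AveragedNS, §1.3]; C. L.
Fefferman, Clay problem description, (C) [cite: FeffermanClay2006, (C)].
-/

noncomputable section

namespace Summit.NavierStokesRegularity.FluidComputer.TriggeredTransfer

open Set MeasureTheory Function Filter Metric
open scoped ENNReal ContDiff NNReal Topology
open Literature.Analysis.FluidPDE
open Literature.Analysis.FluidPDE.FluidComputer (E3 Vel)

namespace SteadyBlob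

variable (B : SteadyBlob)

/-! ## The Gavrilov alphabet: a `TriggerScheme` with all static axioms discharged -/

/-- Compactly supported smooth fields decay rapidly (Fefferman (4)); same proof as the tree's
`HasRapidSpatialDecay.of_hasCompactSupport` (file `NSLerayHopfSereginEnergyProofs`), restated
privately to keep that file's Kato import chain out of this one. [folklore] -/
private theorem hasRapidSpatialDecay_of_hasCompactSupport {v : Vel} (hsm : ContDiff ℝ ∞ v)
    (hc : HasCompactSupport v) : HasRapidSpatialDecay v := by
  intro n K
  have hcont : Continuous fun x => (1 + ‖x‖) ^ K * ‖iteratedFDeriv ℝ n v x‖ :=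
    ((continuous_const.add continuous_norm).pow K).mul
      (hsm.continuous_iteratedFDeriv (m := n) (mod_cast le_top)).norm
  have hsupp : HasCompactSupport fun x => (1 + ‖x‖) ^ K * ‖iteratedFDeriv ℝ n v x‖ :=
    ((hc.iteratedFDeriv n).norm).mul_left
  obtain ⟨C, hC⟩ := hcont.bounded_above_of_compact_support hsupp
  refine ⟨C, fun x => ?_⟩
  have h := hC x
  rwa [Real.norm_eq_abs, abs_of_nonneg (by positivity)] at h

/-- **The Gavrilov alphabet** — a one-shot triggered-transfer scheme with every static axiom
discharged: `λ = 2`, `η = 1` (Kelvin floor `1 < ηλ = 2`), threshold `U⋆ = 1`, family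
`F U = {x ↦ U • G x}` (Clay data: smooth, divergence free, compactly supported hence rapidly
decaying; speed `U ‖G x⋆‖` at `x⋆ ∈ B(0, r) ⊆ B̄(0, 5r)`), nest radius `R = 5r`, speed-floor constant
`c = ‖G x⋆‖`, displacement bound `D = 4r`, trigger constants `A i = sup ‖Dⁱ g‖` of the transplant
force, e-fold budget `a = 1`, time law `C_τ = 4`, `q = 0`. A bona fide term of the door's type —
and, by `step_one`, one whose `Step` is inhabited at `ν = 0`, `ε = 1`. WHAT THIS IS NOT: no claim
that this scheme `Transfers` at any viscosity. [folklore] -/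
def scheme : TriggerScheme where
  lam := 2
  eta := 1
  UStar := 1
  F U := {fun x => U • B.G x}
  R := 5 * B.r
  c := ‖B.G B.xStar‖
  D := 4 * B.r
  A i := Classical.choose (B.trig_bounded i)
  a := 1
  Cτ := 4
  q := 0
  one_lt_lam := by norm_num
  kelvin := by norm_num
  eta_le_one := le_rfl
  UStar_pos := one_pos
  R_pos := by linarith [B.r_pos]
  c_pos := norm_pos_iff.mpr B.G_xStar_ne
  D_nonneg := by linarith [B.r_pos]
  A_nonneg i := (norm_nonneg _).trans (Classical.choose_spec (B.trig_bounded i) 0)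
  a_pos := one_pos
  Cτ_pos := by norm_num
  clay U _ w hw := by
    rw [Set.mem_singleton_iff] at hw
    subst hw
    have hc : HasCompactSupport fun x => U • B.G x :=
      HasCompactSupport.intro (isCompact_closedBall (0 : E3) B.r) fun x hx => by
        rw [B.G_eq_zero (le_of_lt (by simpa [mem_closedBall, dist_eq_norm] using hx)), smul_zero]
    exact ⟨B.smooth_G.const_smul U,
      VectorCalculus.IsDivFree.const_smul (B.smooth_G.differentiable (by simp)) B.divFree U,
      hasRapidSpatialDecay_of_hasCompactSupport (B.smooth_G.const_smul U) hc⟩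
  floor U hU w hw := by
    rw [Set.mem_singleton_iff] at hw
    subst hw
    refine ⟨B.xStar, by linarith [B.norm_xStar_lt, B.r_pos], ?_⟩
    rw [norm_smul, Real.norm_of_nonneg (by linarith), mul_comm]
  seed := ⟨1, le_rfl, ⟨fun x => (1 : ℝ) • B.G x, rfl⟩⟩

/-- The growth factor of the Gavrilov alphabet is `(ηλ)^{1/2} = √2`. [folklore] -/
theorem growth_scheme : B.scheme.growth = Real.sqrt 2 := by
  simp [TriggerScheme.growth, scheme]

/-- The transplant force is an admissible trigger of amplitude `ε = 1`, margin `δ = 1`, hand-over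
time `T = 4` for the Gavrilov alphabet: smooth, off before `t = 2 ≥ δ` and after `t = 3 ≤ T`, off
outside `B(0, 5r)`, derivatives within the constants `A i` by their definition. [folklore] -/
theorem isTrigger_trig : B.scheme.IsTrigger 1 1 4 B.trig where
  smooth := B.contDiff_trig
  off_early t ht := by
    funext x
    simp [trig, deriv_fade_of_lt_two (show t < 2 by linarith)]
  off_late t ht := by
    funext x
    simp [trig, deriv_fade_of_three_lt (show (3 : ℝ) < t by linarith)]
  off_far t x hx := by
    have hx5 : 5 * B.r ≤ ‖x‖ := hx
    have h1 : B.r ≤ ‖x‖ := by linarith [B.r_pos]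
    simp [trig, B.W₂_eq_zero hx5, B.G_eq_zero h1]
  small i z := by
    rw [one_mul]
    exact Classical.choose_spec (B.trig_bounded i) z

/-- **`TriggerScheme.Step` IS INHABITED (ν = 0, ε = 1).** For the Gavrilov alphabet, one triggered
transfer from the member `1 • G` at amplitude `U = 1` with unit trigger amplitude holds: hand-over
time `T = 4 ≤ C_τ (1 + |log 1|)^0 / 1`, margin `δ = 1`, trigger = the transplant force, solution =
the transplant (a classical forced Euler flow on `[0, 5]`, finite energy), `u 0 = 1 • G`, and
`u 4 = W₂ = x ↦ λ • w′ (λ • (x - x₀))` with `w′ = √2 • G ∈ F √2`, `√2 = (ηλ)^{1/2} · 1`,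
`‖x₀‖ = 4r ≤ D`. The transfer is done by the FORCE; see the module docstring, «Reading».
[folklore] -/
theorem step_one : B.scheme.Step 0 1 1 (fun x => (1 : ℝ) • B.G x) := by
  refine ⟨4, 1, B.trig, B.flow, B.pres, one_pos, by norm_num, ?_, B.isTrigger_trig, B.flow_classical,
    B.flow_zero, B.flow_energy, Real.sqrt 2, fun x => Real.sqrt 2 • B.G x, B.x₀, ?_, rfl, ?_, ?_⟩
  · simp [scheme]
  · rw [growth_scheme, mul_one]
  · simp [scheme, norm_x₀]
  · rw [B.flow_of_three_le (by norm_num)]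
    funext x
    simp [W₂, scheme, smul_smul]

end SteadyBlob

/-! ## Headline corollaries -/

/-- **The door's static type is inhabited**: `Nonempty TriggerScheme` (the Gavrilov alphabet of a
steady Euler blob). [folklore] -/
theorem nonempty_triggerScheme : Nonempty TriggerScheme :=
  ⟨(Classical.choice SteadyBlob.nonempty).scheme⟩

/-- **The door's one-step predicate is inhabited at zero viscosity with a unit trigger**: some
scheme, some amplitude `U ≥ U⋆` and some member `w ∈ F U` admit `Step 0 U 1 w` — by a PRESCRIBED
transplant between two disjointly supported steady Euler blobs (the force does the transfer).
Calibration, not evidence: the content of door N1-FC lies in `Transfers ν`, `ν > 0`, over triggers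
`ε ↓ 0`. [folklore] -/
theorem exists_step_inviscid_unit_trigger :
    ∃ (𝒮 : TriggerScheme) (U : ℝ) (w : Vel), 𝒮.UStar ≤ U ∧ w ∈ 𝒮.F U ∧ 𝒮.Step 0 U 1 w := by
  obtain ⟨B⟩ := SteadyBlob.nonempty
  exact ⟨B.scheme, 1, fun x => (1 : ℝ) • B.G x, le_rfl, rfl, B.step_one⟩

end Summit.NavierStokesRegularity.FluidComputer.TriggeredTransfer

end
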